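import Mathlib
import Literature.Analysis.ValidatedNumerics.WeightedEllOneSequenceAlgebra
import Literature.Analysis.ValidatedNumerics.WeightedEllOneBanach
import HarnessLib

/-!
# The weighted Wiener algebra of power series in several variables is a commutative Banach algebra

Topic `Literature/Analysis/ValidatedNumerics`.  The coefficient spaces of the Taylor / cone-series
route to computer-assisted proofs (`…WeightedEllOneSequenceAlgebra`: real families over an index with
a weighted `ℓ¹` norm and a kernel product; `…WeightedEllOneBanach`: the isometry onto Mathlib's
`ℓ¹(ι, ℝ)`) are stated there as THEOREMS ABOUT FAMILIES — no ring or normed-space instance is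
registered, so the abstract radii-polynomial theorems (`Literature.Analysis.Calculus.RadiiPolynomial`,
`…PolynomialNonlinearity.existsUnique_zero_of_semilin`, which quantify over a real Banach space /
a commutative Banach algebra `R`) apply to them only after a client "identifies its space".  This
file performs that identification ONCE, for the multivariate Taylor case: for a finite set of
variables `σ` and a weight `ω : (σ →₀ ℕ) → ℝ` with

  `0 < ω(n)`,  `ω(0) = 1`,  `ω(p + q) ≤ ω(p) ω(q)`   (`SubmultWeight σ`),

the formal power series `φ ∈ ℝ[[X_σ]]` (Mathlib `MvPowerSeries σ ℝ`, Cauchy product) with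
`‖φ‖_ω := Σ_n |coeff_n φ| ω(n) < ∞` form a subalgebra `wienerSubalgebra ω`, and its carrier type
`Wiener ω` IS a `NormedCommRing` with `‖1‖ = 1` (`NormOneClass`), a `NormedAlgebra ℝ`, and a
`CompleteSpace` — i.e. a commutative unital real Banach algebra, with `‖φψ‖_ω ≤ ‖φ‖_ω ‖ψ‖_ω`
(`norm_mul_le`, from the Cauchy-product formula and the weight inequality) and completeness
transported from `ℓ¹` along the isometry `toEll1` of `…WeightedEllOneBanach`.  The certnum F2 cone
algebra `ℓ¹_ϱ(ζ^a ζ̄^b)` is the case `σ = Fin 2`, `ω(n) = ϱ^{n₀+n₁}` (`coneSubmultWeight`).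

## Sources (verbatim)

* [ArioliKoch2019] G. Arioli, H. Koch, Nonlinear Anal. 179 (2019), §3 p. 7–8: "denote by `A_ρ` the
  real vector space of all functions `u = Σ_m u_m, u_m = Σ_{n∈N_m} u_{m,n} V_n^m` … that have a finite
  norm `‖u‖_ρ = Σ_m ‖u_m‖_ρ, ‖u_m‖_ρ = Σ_n |u_{m,n}|₁ ρ^n` (3.1)–(3.2) … When equipped with this norm,
  `A_ρ` is a Banach space over `ℝ`." and "**Lemma 3.1.** `A_ρ` is a Banach algebra under pointwise
  multiplication."  (Their basis is Zernike's; the plain-monomial cone version has weight `ϱ^{a+b}`,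
  which is exactly multiplicative, so the constant is `1`.)
* [Kaniuth2009] E. Kaniuth, *A Course in Commutative Banach Algebras*, §1.3 Def. 1.3.1 (weight:
  `ω(xy) ≤ ω(x)ω(y)`) and after Cor. 1.3.4 ("`‖f ∗ g‖_{1,ω} ≤ ‖f‖_{1,ω}‖g‖_{1,ω}` … `L¹(G,ω)` is complete …
  a Banach algebra … called the Beurling algebra") — here for the additive monoid `ℕ^σ` instead of a group.
* [HungriaLessardMirelesJames2016] §2.1 p. 1433: "`ℓ¹_ν` is a Banach space and moreover has the property
  of being a Banach algebra under discrete convolution".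

## What is formalised (all PROVED; no axioms beyond the standard three)

`SubmultWeight`, `wienerSubalgebra` (closure under `+`, `·`, scalars, `1`), `Wiener ω` with
`norm_def` (`‖φ‖ = WeightedSeq.wnorm ω (coeff · φ)`), instances `NormedAddCommGroup`, `NormedCommRing`
(`norm_mul_le`), `NormOneClass`, `NormedSpace ℝ` / `NormedAlgebra ℝ`, `CompleteSpace` (via the
isometric equivalence `toLpEquiv` with `lp (fun _ ↦ ℝ) 1`); `coeffFun_mem` / `mk` (membership API) and
`coneSubmultWeight ϱ` (`1 ≤ ϱ`); `kerOp` / `norm_kerOp_le` (a kernel with `WeightedSeq.ColBound … C`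
acts as a bounded linear map `Wiener ω →L[ℝ] Wiener ω` of norm `≤ C`).  The instances live on the NEW
type `Wiener ω` only.

## What is NOT covered

No evaluation / function-theoretic statements (that `φ` defines an analytic function on a polydisk,
pointwise products = Cauchy products of the represented functions): the algebra is the formal one,
which is what a coefficient-space certificate manipulates; no other bases (Chebyshev/cosine kernels
have constant `C ≠ 1` and are not power-series products); no float model.

## Provenance

AI-produced formalisation (cell certnum, seat certnum-ode-2, 2026-08-27): the "client
identification" link named in `RadiiPolynomialPolynomialNonlinearity.lean` and
`ConeDirichletInverseOperator.lean` (WHAT-IS-NOT sections), discharged for multivariate Taylor /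
cone series.
-/

set_option autoImplicit false

open scoped BigOperators
open MvPowerSeries

noncomputable section

namespace Literature.Analysis.ValidatedNumerics

namespace WienerAlgebra

open WeightedSeq

variable {σ : Type*}

/-- A **submultiplicative weight** on the exponents `ℕ^σ`: positive, `ω(0) = 1`, `ω(p+q) ≤ ω(p)ω(q)`
(Beurling's condition, written additively for the monoid of exponents).
[cite: Kaniuth2009, §1.3 Def 1.3.1 (weight function ω(xy) ≤ ω(x)ω(y))] -/
structure SubmultWeight (σ : Type*) where
  /-- the weight -/
  toFun : (σ →₀ ℕ) → ℝ
  /-- positivity -/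
  pos : ∀ n, 0 < toFun n
  /-- normalisation at the zero exponent (so that `‖1‖ = 1`) -/
  map_zero : toFun 0 = 1
  /-- submultiplicativity -/
  map_add_le : ∀ p q, toFun (p + q) ≤ toFun p * toFun q

namespace SubmultWeight

variable (ω : SubmultWeight σ)

/-- [cite: Kaniuth2009, §1.3 Def 1.3.1] -/
theorem nonneg (n : σ →₀ ℕ) : 0 ≤ ω.toFun n := (ω.pos n).le

end SubmultWeight

/-- The coefficient family of a power series, as a plain function on exponents (Mathlib's
`MvPowerSeries σ ℝ` IS this function type; `coeff n φ = φ n` definitionally).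
[cite: ArioliKoch2019, §3 eq. (3.1) (a function is its coefficient family)] -/
def coeffFun (φ : MvPowerSeries σ ℝ) : (σ →₀ ℕ) → ℝ := fun n => coeff n φ

/-- [cite: ArioliKoch2019, §3 eq. (3.1)] -/
@[simp] theorem coeffFun_apply (φ : MvPowerSeries σ ℝ) (n : σ →₀ ℕ) : coeffFun φ n = coeff n φ := rfl

/-- [cite: ArioliKoch2019, §3 eq. (3.1)] -/
theorem coeffFun_add (φ ψ : MvPowerSeries σ ℝ) : coeffFun (φ + ψ) = coeffFun φ + coeffFun ψ := by
  funext n; simp [coeffFun]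

/-- [cite: ArioliKoch2019, §3 eq. (3.1)] -/
theorem coeffFun_smul (r : ℝ) (φ : MvPowerSeries σ ℝ) : coeffFun (r • φ) = fun n => r * coeffFun φ n := by
  funext n; simp [coeffFun]

/-! ### The Cauchy-product estimate -/

/-- **The weighted Cauchy-product estimate.** If `Σ |φ_n| ω(n)` and `Σ |ψ_n| ω(n)` converge then so does
`Σ |(φψ)_n| ω(n)`, and `Σ |(φψ)_n| ω(n) ≤ (Σ |φ_n| ω(n)) (Σ |ψ_n| ω(n))` — from
`(φψ)_n = Σ_{p+q=n} φ_p ψ_q`, `ω(n) ≤ ω(p)ω(q)` and the Cauchy product formula for absolutely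
convergent series.
[cite: ArioliKoch2019, §3 Lemma 3.1 (A_ρ is a Banach algebra); Kaniuth2009 §1.3 after Cor 1.3.4 (‖f∗g‖_{1,ω} ≤ ‖f‖_{1,ω}‖g‖_{1,ω})] -/
theorem mem_mul_and_wnorm_mul_le (ω : SubmultWeight σ) {φ ψ : MvPowerSeries σ ℝ}
    (hφ : Mem ω.toFun (coeffFun φ)) (hψ : Mem ω.toFun (coeffFun ψ)) :
    Mem ω.toFun (coeffFun (φ * ψ)) ∧
      wnorm ω.toFun (coeffFun (φ * ψ)) ≤ wnorm ω.toFun (coeffFun φ) * wnorm ω.toFun (coeffFun ψ) := by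
  classical
  -- the two nonnegative summable families and their Cauchy product
  set F : (σ →₀ ℕ) → ℝ := fun n => |coeff n φ| * ω.toFun n with hF
  set G : (σ →₀ ℕ) → ℝ := fun n => |coeff n ψ| * ω.toFun n with hG
  have hF0 : 0 ≤ F := fun n => mul_nonneg (abs_nonneg _) (ω.nonneg n)
  have hG0 : 0 ≤ G := fun n => mul_nonneg (abs_nonneg _) (ω.nonneg n)
  have hFs : Summable F := hφ
  have hGs : Summable G := hψ
  have hFG : Summable fun x : (σ →₀ ℕ) × (σ →₀ ℕ) => F x.1 * G x.2 := hFs.mul_of_nonneg hGs hF0 hG0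
  set H : (σ →₀ ℕ) → ℝ := fun n => ∑ kl ∈ Finset.HasAntidiagonal.antidiagonal n, F kl.1 * G kl.2 with hH
  have hHs : Summable H := summable_sum_mul_antidiagonal_of_summable_mul hFG
  have hHsum : ∑' n, H n = (∑' n, F n) * ∑' n, G n :=
    (hFs.tsum_mul_tsum_eq_tsum_sum_antidiagonal hGs hFG).symm
  -- termwise comparison |(φψ)_n| ω n ≤ H n
  have hle : ∀ n, |coeff n (φ * ψ)| * ω.toFun n ≤ H n := by
    intro n
    rw [coeff_mul]
    calc |∑ kl ∈ Finset.HasAntidiagonal.antidiagonal n, coeff kl.1 φ * coeff kl.2 ψ| * ω.toFun n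
        ≤ (∑ kl ∈ Finset.HasAntidiagonal.antidiagonal n, |coeff kl.1 φ * coeff kl.2 ψ|) * ω.toFun n :=
          mul_le_mul_of_nonneg_right (Finset.abs_sum_le_sum_abs _ _) (ω.nonneg n)
      _ = ∑ kl ∈ Finset.HasAntidiagonal.antidiagonal n, |coeff kl.1 φ * coeff kl.2 ψ| * ω.toFun n :=
          Finset.sum_mul _ _ _
      _ ≤ H n := by
          refine Finset.sum_le_sum fun kl hkl => ?_
          rw [Finset.HasAntidiagonal.mem_antidiagonal] at hkl
          have hω := ω.map_add_le kl.1 kl.2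
          rw [hkl] at hω
          have h1 : 0 ≤ |coeff kl.1 φ| * |coeff kl.2 ψ| := mul_nonneg (abs_nonneg _) (abs_nonneg _)
          rw [abs_mul]
          calc |coeff kl.1 φ| * |coeff kl.2 ψ| * ω.toFun n
              ≤ |coeff kl.1 φ| * |coeff kl.2 ψ| * (ω.toFun kl.1 * ω.toFun kl.2) :=
                mul_le_mul_of_nonneg_left hω h1
            _ = |coeff kl.1 φ| * ω.toFun kl.1 * (|coeff kl.2 ψ| * ω.toFun kl.2) := by ring
  have hnn : ∀ n, 0 ≤ |coeff n (φ * ψ)| * ω.toFun n := fun n => mul_nonneg (abs_nonneg _) (ω.nonneg n)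
  have hmem : Mem ω.toFun (coeffFun (φ * ψ)) := Summable.of_nonneg_of_le hnn hle hHs
  refine ⟨hmem, ?_⟩
  unfold wnorm
  calc ∑' n, |coeffFun (φ * ψ) n| * ω.toFun n ≤ ∑' n, H n := hmem.tsum_le_tsum hle hHs
    _ = (∑' n, F n) * ∑' n, G n := hHsum

/-! ### The subalgebra and its carrier type -/

/-- **The weighted Wiener subalgebra** of `ℝ[[X_σ]]`: power series with `Σ_n |coeff_n φ| ω(n) < ∞`.
Closed under sums, scalar multiples, constants and — by `mem_mul_and_wnorm_mul_le` — products.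
[cite: ArioliKoch2019, §3 (3.1)–(3.2) and Lemma 3.1; Kaniuth2009 §1.3 (Beurling algebra)] -/
def wienerSubalgebra (ω : SubmultWeight σ) : Subalgebra ℝ (MvPowerSeries σ ℝ) where
  carrier := {φ | Mem ω.toFun (coeffFun φ)}
  mul_mem' {φ ψ} hφ hψ := (mem_mul_and_wnorm_mul_le ω hφ hψ).1
  one_mem' := by
    classical
    refine mem_of_support_subset ω.toFun {0} fun n hn => ?_
    rw [Finset.mem_singleton] at hn
    simp [coeffFun, coeff_one, hn]
  add_mem' {φ ψ} hφ hψ := by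
    show Mem ω.toFun (coeffFun (φ + ψ))
    rw [coeffFun_add]
    exact hφ.add ω.nonneg hψ
  zero_mem' := by
    refine mem_of_support_subset ω.toFun ∅ fun n _ => ?_
    simp [coeffFun]
  algebraMap_mem' r := by
    classical
    refine mem_of_support_subset ω.toFun {0} fun n hn => ?_
    rw [Finset.mem_singleton] at hn
    rw [MvPowerSeries.algebraMap_apply]
    simp [coeffFun, coeff_C, hn]

/-- **The weighted Wiener algebra** `W_ω = ℓ¹_ω(ℕ^σ)` with the Cauchy product, as a type.
[cite: ArioliKoch2019, §3 Lemma 3.1; Kaniuth2009 §1.3 (Beurling algebra)] -/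
abbrev Wiener (ω : SubmultWeight σ) : Type _ := ↥(wienerSubalgebra ω)

namespace Wiener

variable {ω : SubmultWeight σ}

/-- Membership unfolded. [cite: ArioliKoch2019, §3 (3.2)] -/
theorem mem_iff (φ : MvPowerSeries σ ℝ) : φ ∈ wienerSubalgebra ω ↔ Mem ω.toFun (coeffFun φ) := Iff.rfl

/-- The coefficient family of an element is in `ℓ¹_ω`. [cite: ArioliKoch2019, §3 (3.2)] -/
theorem coeffFun_mem (φ : Wiener ω) : Mem ω.toFun (coeffFun (φ : MvPowerSeries σ ℝ)) := φ.2

/-- Build an element from a power series with summable weighted coefficients.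
[cite: ArioliKoch2019, §3 (3.1)–(3.2)] -/
def mk (φ : MvPowerSeries σ ℝ) (h : Mem ω.toFun (coeffFun φ)) : Wiener ω := ⟨φ, h⟩

/-- **The norm** `‖φ‖_ω = Σ_n |coeff_n φ| ω(n)` (= `WeightedSeq.wnorm`).
[cite: ArioliKoch2019, §3 eq. (3.2)] -/
def wn (φ : Wiener ω) : ℝ := wnorm ω.toFun (coeffFun (φ : MvPowerSeries σ ℝ))

/-- [folklore] -/
private theorem coeffFun_coe_add (φ ψ : Wiener ω) :
    coeffFun ((φ + ψ : Wiener ω) : MvPowerSeries σ ℝ)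
      = coeffFun (φ : MvPowerSeries σ ℝ) + coeffFun (ψ : MvPowerSeries σ ℝ) := by
  rw [Subalgebra.coe_add, coeffFun_add]

/-- [folklore] -/
private theorem coeffFun_coe_neg (φ : Wiener ω) :
    coeffFun ((-φ : Wiener ω) : MvPowerSeries σ ℝ) = -coeffFun (φ : MvPowerSeries σ ℝ) := by
  rw [Subalgebra.coe_neg]; funext n; simp [coeffFun]

/-- The norm as an `AddGroupNorm` (triangle inequality `WeightedSeq.wnorm_add_le`, definiteness from
`ω > 0`). [cite: ArioliKoch2019, §3 ("When equipped with this norm, A_ρ is a Banach space over ℝ")] -/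
def addGroupNorm (ω : SubmultWeight σ) : AddGroupNorm (Wiener ω) where
  toFun := wn
  map_zero' := by
    show wnorm ω.toFun (coeffFun ((0 : Wiener ω) : MvPowerSeries σ ℝ)) = 0
    rw [Subalgebra.coe_zero]
    simp [wnorm, coeffFun]
  add_le' φ ψ := by
    show wnorm ω.toFun (coeffFun ((φ + ψ : Wiener ω) : MvPowerSeries σ ℝ)) ≤ wn φ + wn ψ
    rw [coeffFun_coe_add]
    exact wnorm_add_le ω.nonneg (coeffFun_mem φ) (coeffFun_mem ψ)
  neg' φ := by
    show wnorm ω.toFun (coeffFun ((-φ : Wiener ω) : MvPowerSeries σ ℝ)) = wn φ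
    rw [coeffFun_coe_neg, wnorm_neg]
    rfl
  eq_zero_of_map_eq_zero' φ h := by
    have hmem := coeffFun_mem φ
    have h' : ∑' n, |coeffFun (φ : MvPowerSeries σ ℝ) n| * ω.toFun n = 0 := h
    have h0 : ∀ n, |coeffFun (φ : MvPowerSeries σ ℝ) n| * ω.toFun n = 0 := by
      have hnn : ∀ n, 0 ≤ |coeffFun (φ : MvPowerSeries σ ℝ) n| * ω.toFun n :=
        fun n => mul_nonneg (abs_nonneg _) (ω.nonneg n)
      have hs := hmem.hasSum
      rw [h'] at hs
      exact funext_iff.1 ((hasSum_zero_iff_of_nonneg hnn).1 hs)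
    refine Subtype.ext ?_
    ext n
    have := h0 n
    rw [mul_eq_zero, abs_eq_zero] at this
    rcases this with h1 | h1
    · simpa [coeffFun] using h1
    · exact absurd h1 (ω.pos n).ne'

/-- `Wiener ω` is a normed additive group with `‖φ‖ = Σ |coeff_n φ| ω(n)`.
[cite: ArioliKoch2019, §3 (A_ρ is a Banach space)] -/
instance instNormedAddCommGroup : NormedAddCommGroup (Wiener ω) :=
  AddGroupNorm.toNormedAddCommGroup (addGroupNorm ω)

/-- The norm is the weighted `ℓ¹` norm of the coefficient family.
[cite: ArioliKoch2019, §3 eq. (3.2)] -/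
theorem norm_def (φ : Wiener ω) : ‖φ‖ = wnorm ω.toFun (coeffFun (φ : MvPowerSeries σ ℝ)) := rfl

/-- **`Wiener ω` is a commutative normed ring:** `‖φψ‖ ≤ ‖φ‖‖ψ‖`.
[cite: ArioliKoch2019, §3 Lemma 3.1 (Banach algebra under multiplication); Kaniuth2009 §1.3] -/
instance instNormedCommRing : NormedCommRing (Wiener ω) :=
  { (inferInstance : CommRing (Wiener ω)), (inferInstance : NormedAddCommGroup (Wiener ω)) with
    norm_mul_le := fun φ ψ => by
      rw [norm_def, norm_def, norm_def, Subalgebra.coe_mul]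
      exact (mem_mul_and_wnorm_mul_le ω (coeffFun_mem φ) (coeffFun_mem ψ)).2 }

/-- `‖1‖ = 1` (because `ω(0) = 1`). [cite: Kaniuth2009, §1.3 (unital Beurling algebra)] -/
instance instNormOneClass : NormOneClass (Wiener ω) := by
  classical
  refine ⟨?_⟩
  rw [norm_def, Subalgebra.coe_one]
  have hz : ∀ n, n ∉ ({0} : Finset (σ →₀ ℕ)) → coeffFun (1 : MvPowerSeries σ ℝ) n = 0 := by
    intro n hn
    rw [Finset.mem_singleton] at hn
    simp [coeffFun, coeff_one, hn]
  rw [wnorm_eq_sum_of_support_subset ω.toFun {0} hz, Finset.sum_singleton]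
  simp [coeffFun, coeff_one, ω.map_zero]

/-- `‖r • φ‖ ≤ |r| ‖φ‖` (in fact equality): `Wiener ω` is a normed `ℝ`-space.
[cite: ArioliKoch2019, §3 (A_ρ is a Banach space over ℝ)] -/
instance instNormedSpace : NormedSpace ℝ (Wiener ω) where
  norm_smul_le r φ := by
    rw [norm_def, norm_def, Subalgebra.coe_smul, coeffFun_smul, Real.norm_eq_abs]
    exact le_of_eq (wnorm_const_mul _ _)

/-- `Wiener ω` is a normed `ℝ`-algebra. [cite: ArioliKoch2019, §3 Lemma 3.1] -/
instance instNormedAlgebra : NormedAlgebra ℝ (Wiener ω) :=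
  { (inferInstance : Algebra ℝ (Wiener ω)) with
    norm_smul_le := fun r φ => norm_smul_le r φ }

/-! ### Completeness, transported from `ℓ¹` -/

/-- The isometry onto Mathlib's `ℓ¹`: `φ ↦ (coeff_n φ · ω(n))_n` (`WeightedSeq.toEll1`).
[cite: HungriaLessardMirelesJames2016, §2.1 p. 1433 ("ℓ¹_ν is a Banach space")] -/
def toLp (φ : Wiener ω) : lp (fun _ : σ →₀ ℕ => ℝ) 1 := toEll1 ω.toFun (coeffFun (φ : MvPowerSeries σ ℝ))

/-- The inverse map: an `ℓ¹` family `x` gives the power series with coefficients `x_n / ω(n)`.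
[cite: HungriaLessardMirelesJames2016, §2.1 p. 1433] -/
def ofLp (x : lp (fun _ : σ →₀ ℕ => ℝ) 1) : Wiener ω :=
  ⟨(ofEll1 ω.toFun x : MvPowerSeries σ ℝ), by
    show Mem ω.toFun (coeffFun (ofEll1 ω.toFun x))
    exact mem_ofEll1 ω.pos x⟩

/-- `Wiener ω ≃ᵢ ℓ¹`: the weighted coefficient map is a bijective isometry.
[cite: HungriaLessardMirelesJames2016, §2.1 p. 1433 (ℓ¹_ν is a Banach space)] -/
def toLpEquiv (ω : SubmultWeight σ) : Wiener ω ≃ᵢ lp (fun _ : σ →₀ ℕ => ℝ) 1 where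
  toFun := toLp
  invFun := ofLp
  left_inv φ := by
    refine Subtype.ext ?_
    show (ofEll1 ω.toFun (toEll1 ω.toFun (coeffFun (φ : MvPowerSeries σ ℝ))) : MvPowerSeries σ ℝ)
      = (φ : MvPowerSeries σ ℝ)
    rw [ofEll1_toEll1 ω.pos (coeffFun_mem φ)]
    rfl
  right_inv x := by
    show toEll1 ω.toFun (coeffFun (ofEll1 ω.toFun x : MvPowerSeries σ ℝ)) = x
    exact toEll1_ofEll1 ω.pos x
  isometry_toFun := by
    refine Isometry.of_dist_eq fun φ ψ => ?_
    have hφ := coeffFun_mem φ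
    have hψ := coeffFun_mem ψ
    have e1 : dist (toLp φ) (toLp ψ)
        = wnorm ω.toFun (coeffFun (φ : MvPowerSeries σ ℝ) - coeffFun (ψ : MvPowerSeries σ ℝ)) := by
      rw [dist_eq_norm, toLp, toLp, ← toEll1_sub ω.pos hφ hψ, norm_toEll1 ω.pos (hφ.sub ω.nonneg hψ)]
    have e2 : dist φ ψ = wnorm ω.toFun (coeffFun ((φ - ψ : Wiener ω) : MvPowerSeries σ ℝ)) := by
      rw [dist_eq_norm, norm_def]
    have e3 : coeffFun ((φ - ψ : Wiener ω) : MvPowerSeries σ ℝ)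
        = coeffFun (φ : MvPowerSeries σ ℝ) - coeffFun (ψ : MvPowerSeries σ ℝ) := by
      rw [Subalgebra.coe_sub]; funext n; simp [coeffFun]
    rw [e1, e2, e3]

/-- **`Wiener ω` is complete** (a Banach algebra): transported from `ℓ¹` along `toLpEquiv`.
[cite: ArioliKoch2019, §3 Lemma 3.1 (Banach algebra); Kaniuth2009 §1.3 (L¹(G,ω) is complete)] -/
instance instCompleteSpace : CompleteSpace (Wiener ω) := (toLpEquiv ω).completeSpace

/-! ### Kernel operators on `Wiener ω` -/

/-- **A kernel operator with a weighted column bound is a bounded linear map on `Wiener ω`:**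
`(T_M φ)_k = Σ_m M(k,m) φ_m` with `Σ_k |M(k,m)| ω(k) ≤ C ω(m)` for every column `m`
(`WeightedSeq.ColBound`) defines `kerOp : Wiener ω →L[ℝ] Wiener ω` with `‖kerOp‖ ≤ C`
(`norm_kerOp_le`).  This is how the operators of a coefficient-space certificate (`A = A_N ⊕ I`,
`Δ_D⁻¹`, `I − A·DF(x̄)`) become the bounded linear maps of the abstract theorems.
[cite: HungriaLessardMirelesJames2016, Cor. 1 p. 1434 (A ∈ B(ℓ¹_ν, ℓ¹_ν), ‖A‖ ≤ max(K, δ))] -/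
def kerOp {M : (σ →₀ ℕ) → (σ →₀ ℕ) → ℝ} {C : ℝ} (hC : 0 ≤ C)
    (hcol : ColBound ω.toFun ω.toFun M C) : Wiener ω →L[ℝ] Wiener ω :=
  LinearMap.mkContinuous
    { toFun := fun φ =>
        ⟨(apply M (coeffFun (φ : MvPowerSeries σ ℝ)) : MvPowerSeries σ ℝ),
          (wnorm_apply_le ω.nonneg ω.nonneg hC hcol (coeffFun_mem φ)).1⟩
      map_add' := fun φ ψ => by
        refine Subtype.ext ?_
        show apply M (coeffFun ((φ + ψ : Wiener ω) : MvPowerSeries σ ℝ))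
          = apply M (coeffFun (φ : MvPowerSeries σ ℝ)) + apply M (coeffFun (ψ : MvPowerSeries σ ℝ))
        rw [coeffFun_coe_add]
        exact apply_add ω.nonneg ω.pos hC hcol (coeffFun_mem φ) (coeffFun_mem ψ)
      map_smul' := fun r φ => by
        refine Subtype.ext ?_
        show apply M (coeffFun ((r • φ : Wiener ω) : MvPowerSeries σ ℝ))
          = r • apply M (coeffFun (φ : MvPowerSeries σ ℝ))
        rw [Subalgebra.coe_smul, ← apply_smul]
        congr 1 }
    C
    (fun φ => by
      obtain ⟨_, hle⟩ := wnorm_apply_le ω.nonneg ω.nonneg hC hcol (coeffFun_mem φ)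
      rw [norm_def, norm_def]
      exact hle)

/-- The coefficients of `kerOp φ` are the kernel sums `Σ_m M(k,m) φ_m` (`WeightedSeq.apply`).
[cite: HungriaLessardMirelesJames2016, Cor. 1 p. 1434] -/
theorem coeff_kerOp {M : (σ →₀ ℕ) → (σ →₀ ℕ) → ℝ} {C : ℝ} (hC : 0 ≤ C)
    (hcol : ColBound ω.toFun ω.toFun M C) (φ : Wiener ω) (k : σ →₀ ℕ) :
    coeff k ((kerOp hC hcol φ : Wiener ω) : MvPowerSeries σ ℝ)
      = apply M (coeffFun (φ : MvPowerSeries σ ℝ)) k := rfl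

/-- **`‖kerOp‖ ≤ C`** (operator norm by weighted columns).
[cite: HungriaLessardMirelesJames2016, Cor. 1 p. 1434 ("‖A‖ ≤ max(K, δ)")] -/
theorem norm_kerOp_le {M : (σ →₀ ℕ) → (σ →₀ ℕ) → ℝ} {C : ℝ} (hC : 0 ≤ C)
    (hcol : ColBound ω.toFun ω.toFun M C) : ‖kerOp (ω := ω) hC hcol‖ ≤ C :=
  LinearMap.mkContinuous_norm_le _ hC _

end Wiener

/-! ### The cone weight `ϱ^{n₀+n₁}` (certnum F2) -/

/-- The total degree `|n| = Σ_i n_i` as an additive map (Mathlib `Finsupp.degree`), and the geometric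
weight `ϱ^{|n|}`: multiplicative (`ϱ^{|p+q|} = ϱ^{|p|} ϱ^{|q|}`), `= 1` at `0`, positive for `ϱ > 0` — a
`SubmultWeight` for `ϱ ≥ 1` (indeed for `ϱ > 0`).  With `σ = Fin 2` this is the weight of the cone algebra
`ℓ¹_ϱ(ζ^aζ̄^b)`.
[cite: ArioliKoch2019, §3 eq. (3.2) (weight ρ^n on degree-n terms)] -/
def geomSubmultWeight (σ : Type*) {ϱ : ℝ} (hϱ : 0 < ϱ) : SubmultWeight σ where
  toFun n := ϱ ^ (Finsupp.degree n)
  pos n := pow_pos hϱ _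
  map_zero := by simp
  map_add_le p q := by rw [map_add, pow_add]

/-- The certnum cone algebra weight: `σ = Fin 2`, `ω(n) = ϱ^{n₀+n₁}`, `ϱ ≥ 1`.
[cite: ArioliKoch2019, §3 eq. (3.2)] -/
def coneSubmultWeight {ϱ : ℝ} (hϱ : 1 ≤ ϱ) : SubmultWeight (Fin 2) :=
  geomSubmultWeight (Fin 2) (lt_of_lt_of_le one_pos hϱ)

/-- [cite: ArioliKoch2019, §3 eq. (3.2)] -/
theorem coneSubmultWeight_apply {ϱ : ℝ} (hϱ : 1 ≤ ϱ) (n : Fin 2 →₀ ℕ) :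
    (coneSubmultWeight hϱ).toFun n = ϱ ^ (n 0 + n 1) := by
  have hd : Finsupp.degree n = n 0 + n 1 := by rw [Finsupp.degree_eq_sum, Fin.sum_univ_two]
  rw [← hd]
  rfl

end WienerAlgebra

end Literature.Analysis.ValidatedNumerics
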